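import Summits.BirchSwinnertonDyer.Rank1Residual.GaloisImage.ThreeCongruenceHesseCertificatesBatch5
import Summits.BirchSwinnertonDyer.Rank1Residual.GaloisImage.ThreeCongruenceHesseCertificatesBatch6
import Literature.NumberTheory.EllipticCurves.Fisher2012.HesseFamilyThreeReverseProofs
import Summits.BirchSwinnertonDyer.Rank1Residual.Additive.X4ThreeVisibleRowShape38736g1
import Summits.BirchSwinnertonDyer.Rank1Residual.Additive.X4ThreeVisibleRowShape38754h1
import Summits.BirchSwinnertonDyer.BirchSwinnertonDyer.Theorems.Rank2ObservatoryKernelCerts1097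
import Summits.BirchSwinnertonDyer.BirchSwinnertonDyer.Theorems.Rank2ObservatoryKernelWalk23a3
import HarnessLib

/-!
# T-VIS3-REC row shapes with the C-VIS `θ/hθ` column AND the rank column DISCHARGED IN THE KERNEL —
# batch `Batch6`: 38736g1, 38754h1
# (cell `b2b-bsdres`, team n1011, ROW T-VIS3-TH; seat p07 lineage; skeleton cells/n1011/skel/T-VIS3-TH.md;
# generated by `tools/gen_twins.py` from the TREE text of the p18-lineage shapes — consumed BY NAME, nothing edited)

HONEST FRAMING (cell `b2b-bsdres`, run/shared/lean/b2b/bsd-rank1-residual/, verbatim in every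
file): the goal of the cell is to DELETE the COMBINATION-SHAPED residual classes of the
Birch–Swinnerton-Dyer formula for ALL analytic-rank `≤ 1` elliptic curves over `ℚ` — "full BSD
formula for every rank `≤ 1` curve in class `C`" assembled STRICTLY from published theorems — so
that the rank-`≤ 1` remainder becomes exactly the CONSTRUCTION-SHAPED classes, which are TYPED
(missing-input `Prop`s), NOT attempted. This is not "finishing BSD". Team n1011 (N11 = X4 ∧ `p = 3`):
research route; RECORD theorems only — NO definition, NO new named fact, NO `sorry`; a record closes
NO class and moves no mark / label / count; nothing booked; census count unchanged.

## What

Same construction as `Additive/X4ThreeVisibleRowShapesThetaFree.lean` (ROW T-VIS3-TH FILE 2): for each row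
`bsdp3_visHesse_v<E>` := `bsdp3_vis_v<E>` with `(W') (hW') [W'.IsElliptic] (θ) (hθ)` ↦ the literal partner +
`VisCerts.torsionIso3_<E′>_<E>_of_integralModelInt` (`GaloisImage/ThreeCongruenceHesseCertificatesBatch5, ThreeCongruenceHesseCertificatesBatch6`; DUAL pairs are unconditional — A243 is the tree theorem
`Fisher2012.thm132rev_threeCongruent_dualHessePencil_holds`, inside the certificate file or fed here) and `(hrank)` ↦ the
bsd-rank2-observatory kernel certificate of the partner (per-curve `KernelCerts<f>.C<E′>.two_le_rank` or the
walker list `two_le_mordellWeilRank_of_mem_kernelCertRowsW<f>`), BY NAME.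

| row | partner | kind | θ certificate | rank certificate |
|---|---|---|---|---|
| 38736g1 | 38736e1 | (M) | direct | percurve |
| 38754h1 | 116262b1 | (G) | direct | walk |

Binders left per row: the named facts of the (M)/(G) chain, `hr : r_an = 0`, `hq/hv : ord₃ #Ш_an ≤ 2`
(+ `D/hc` on (G) rows). References: [CremonaMazur2000] §3; [Fisher2012Hessian] Thm. 13.2 / §13;
[CremonaAlgorithms1997] §3.5; [SilvermanAEC2009] VIII.6.7.
-/

set_option autoImplicit false

noncomputable section

open scoped Classical NumberField
open IsDedekindDomain NumberField WeierstrassCurve Rat.HeightOneSpectrum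
  Literature.NumberTheory.EllipticCurves Literature.NumberTheory.EllipticCurves.ModularForms
  Literature.NumberTheory.EllipticCurves.Rank1Residual
  Literature.NumberTheory.EllipticCurves.Rank1Residual.Typed
  Literature.NumberTheory.EllipticCurves.Fisher2012
  Literature.NumberTheory.GaloisRepresentations
  Summit.BirchSwinnertonDyer.BirchSwinnertonDyer.Rank1Residual.IntModel
  Summit.BirchSwinnertonDyer.BirchSwinnertonDyer.Rank1Residual.X11RankOne
  Summit.BirchSwinnertonDyer.BirchSwinnertonDyer.Rank2Observatory.Tam
  Summit.BirchSwinnertonDyer.BirchSwinnertonDyer.Rank2Observatory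
  Summit.BirchSwinnertonDyer.Rank1Residual.GaloisImage

namespace Summit.BirchSwinnertonDyer.Rank1Residual.Additive

/-- **T-VIS3 row `38736g1` ((M); partner `38736e1`, DIRECT certificate) with θ/hθ AND hrank DISCHARGED**
— p18-lineage shape `bsdp3_vis_v38736g1` fed with
`VisCerts.torsionIso3_38736e1_38736g1_of_integralModelInt` and the bsdr2 kernel certificate
`KernelCerts1097.C38736e1.two_le_rank`. BINDERS LEFT = {named facts, hr, hq/hv}; closes nothing
beyond them; nothing booked; census count unchanged.
[cite: CremonaMazur2000, §3 and Table 1] [cite: Fisher2012Hessian, Thm. 13.2 (n = 3)] -/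
theorem bsdp3_visHesse_v38736g1
    (hKatoS : Kato2004.rankZero_padicValNat_sha_le_sub_localTamagawa_of_additive_potGood_of_imageContainsSL2)
    (hDel : Delbourgo1998.prop4_rankZero_pow_dvd_constantCoeff)
    (hGZK : rank_eq_analyticRank_of_analyticRank_le_one) (hmod : hasEntireLFunction_rat)
    (hmodD : nonempty_modularParametrizationData)
    (hKatoχ : Wuthrich2014.kato_halfEigenCharIdeal_dvd_cyclotomicPrime_of_surjective)
    (hCT : exists_casselsTate_pairing (K := ℚ))
    (W : WeierstrassCurve ℚ) [W.IsElliptic] [W.IsGloballyMinimal]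
    (hI : integralModelInt W = ⟨0, 0, 0, 146949, -1912534⟩)
    (hr : W.analyticRank = 0)
    {q : ℚ} (hq : shaAn W = (q : ℂ)) (hv : padicValRat 3 q ≤ 2) :
    haveI : Fact (Nat.Prime 3) := ⟨Nat.prime_three⟩
    BSDp W 3 := by
  haveI : (⟨0, 0, 0, -192, -52⟩ : WeierstrassCurve ℚ).IsElliptic :=
    ⟨by rw [isUnit_iff_ne_zero]
        norm_num [WeierstrassCurve.Δ, WeierstrassCurve.b₂, WeierstrassCurve.b₄, WeierstrassCurve.b₆,
          WeierstrassCurve.b₈]⟩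
  obtain ⟨θ, hθ⟩ := VisCerts.torsionIso3_38736e1_38736g1_of_integralModelInt W hI ⟨0, 0, 0, -192, -52⟩ rfl
  have hE' : (⟨0, 0, 0, -192, -52⟩ : WeierstrassCurve ℤ).map (Int.castRingHom ℚ) =
      (⟨0, 0, 0, -192, -52⟩ : WeierstrassCurve ℚ) := by
    ext <;> simp [WeierstrassCurve.map]
  have hrank : 2 ≤ (⟨0, 0, 0, -192, -52⟩ : WeierstrassCurve ℚ).mordellWeilRank := by
    rw [← hE']; exact KernelCerts1097.C38736e1.two_le_rank
  exact bsdp3_vis_v38736g1 hKatoS hDel hGZK hmod hmodD hKatoχ hCT W hI hr hq hv _ rfl θ hθ hrank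

/-- **T-VIS3 row `38754h1` ((G); partner `116262b1`, DIRECT certificate) with θ/hθ AND hrank
DISCHARGED** — p18-lineage shape `bsdp3_vis_v38754h1` fed with
`VisCerts.torsionIso3_116262b1_38754h1_of_integralModelInt` and the bsdr2 walker-list certificate
(`KernelWalk23a3`, membership by `decide`). BINDERS LEFT = {named facts, hr, hq/hv, D/hc}; closes
nothing beyond them; nothing booked; census count unchanged.
[cite: CremonaMazur2000, §3 and Table 1] [cite: Fisher2012Hessian, Thm. 13.2 (n = 3)] -/
theorem bsdp3_visHesse_v38754h1
    (hKato : Kato2004.rankZero_padicValNat_sha_le_of_additive_potGood_of_imageContainsSL2)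
    (hCT : exists_casselsTate_pairing (K := ℚ))
    (hGZK : rank_eq_analyticRank_of_analyticRank_le_one) (hmod : hasEntireLFunction_rat)
    (W : WeierstrassCurve ℚ) [W.IsElliptic] [W.IsGloballyMinimal]
    (hI : integralModelInt W = ⟨1, -1, 1, -398, -2951⟩)
    (hr : W.analyticRank = 0)
    {N : ℕ} [NeZero N] (D : ModularParametrizationData W N) (hc : ¬ ((3 : ℕ) : ℤ) ∣ D.maninConstant)
    {q : ℚ} (hq : shaAn W = (q : ℂ)) (hv : padicValRat 3 q ≤ 2) :
    haveI : Fact (Nat.Prime 3) := ⟨Nat.prime_three⟩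
    BSDp W 3 := by
  haveI : (⟨1, -1, 1, -581, 3517⟩ : WeierstrassCurve ℚ).IsElliptic :=
    ⟨by rw [isUnit_iff_ne_zero]
        norm_num [WeierstrassCurve.Δ, WeierstrassCurve.b₂, WeierstrassCurve.b₄, WeierstrassCurve.b₆,
          WeierstrassCurve.b₈]⟩
  obtain ⟨θ, hθ⟩ := VisCerts.torsionIso3_116262b1_38754h1_of_integralModelInt W hI ⟨1, -1, 1, -581, 3517⟩ rfl
  have hE' : (⟨1, -1, 1, -581, 3517⟩ : WeierstrassCurve ℤ).map (Int.castRingHom ℚ) =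
      (⟨1, -1, 1, -581, 3517⟩ : WeierstrassCurve ℚ) := by
    ext <;> simp [WeierstrassCurve.map]
  have hrank : 2 ≤ (⟨1, -1, 1, -581, 3517⟩ : WeierstrassCurve ℚ).mordellWeilRank := by
    have hw := two_le_mordellWeilRank_of_mem_kernelCertRowsW23a3
      ⟨"116262b1", 1, -1, 1, -581, 3517, 116262, (-1, 64, 1), (47, 256, 1)⟩ (by decide +kernel)
    have hcw : Rank2Row.curve ⟨"116262b1", 1, -1, 1, -581, 3517, 116262, (-1, 64, 1), (47, 256, 1)⟩ =
        (⟨1, -1, 1, -581, 3517⟩ : WeierstrassCurve ℤ).map (Int.castRingHom ℚ) := by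
      ext <;> simp [Rank2Row.curve, WeierstrassCurve.map]
    rw [← hE', ← hcw]; exact hw
  exact bsdp3_vis_v38754h1 hKato hCT hGZK hmod W hI hr D hc hq hv _ rfl θ hθ hrank

end Summit.BirchSwinnertonDyer.Rank1Residual.Additive

end
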